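import Mathlib
import Literature.MathematicalPhysics.StatisticalMechanics.BarlowStacking
import Summits.AtomisticToContinuum.Crystallization.Theorems.ChessboardParticlePlanesLjBilayerHcpNumericReductionSums

/-!
# Crux `ChessboardParticlePlanes.LjBilayerHcp` (stmt-AtomisticToContinuum-6710), line `Sketch` —
# the numeric stub follows from a one-dimensional certificate

The numeric face Sν of the line (`stub_numeric`: every `hcp(a, h)` with `a ≥ 2/3`, `h ≥ 3/4` is beaten by an hcp of the
box `[47/50, 1] × [39a/50, 17a/20]`) is reduced here, by pure real analysis, to

* N1 `stub_hcpPowerSums`: `e(hcp a h) = (1/24)·∑_v [v≠0](a²Q v + k²h²)⁻⁶ − (1/12)·∑_v [v≠0](a²Q v + k²h²)⁻³` (+ summability);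
* N2 `stub_powerSums_antitone`: these power sums decrease in `(a, h)`;
* N5 `stub_powerSum_tail`: an explicit bound `T(t)` for the cube sum outside the index box `|k|, |i|, |j| ≤ 12` at `(1, t)`;
* N4 the CERTIFICATE (hypothesis `hc`, registered as `stub_certificate`): finitely many inequalities between the box
  partial sums `B_n(x) = ∑_{v ∈ box} [v ≠ 0](Q v + k²x²)⁻ⁿ` at rational `x`, the tail bound and `U₀ = −179/250`:
  (U) the box point `(a₀, h₀) = (97/100, 97/100·49/60)` has `e ≤ U₀`; (S) small slope `t = h/a ≤ 1/2`;
  (L) large slope `t ≥ 11/10`; and a covering of `[1/2, 11/10]` by rational intervals `[l, r]` each certified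
  either by (B) `(B₃ l + T l)² ≤ 24 B₆ r (−U₀)` or, inside `[39/50, 17/20]`, by (A) `0.94⁶(B₃ l + T l) ≤ B₆ r` and
  `B₆ l + ρ(l)⁻³ T l ≤ B₃ r` (`ρ(x) = min 1 (min (1/3 + x²) (4x²)) ≤ Q v + k²x²` off the origin).

Mechanism (scaling + AM–GM): with `t = h/a` and `u = a⁻⁶`, `e(hcp a h) = (P₆(t)/24) u² − (P₃(t)/12) u ≥ −P₃(t)²/(24 P₆(t))`,
with equality at `u = P₃/P₆`, i.e. at the hcp `(a', t a')`, `a'⁶ = P₆(t)/P₃(t)`; in case (A) that hcp is in the box, in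
cases (B), (S), (L) the box point `(a₀, h₀)` wins.  All `[folklore]`; no definitions (the abbreviations `Q`, `B`, `T`
enter through binders with defining equations, as in `hcpEnergySeries_of_eq`).  The analytic inputs are in
`…NumericReductionAux.lean` and `…NumericReductionSums.lean`.
-/

noncomputable section

open scoped BigOperators
open Literature.MathematicalPhysics.StatisticalMechanics

namespace Summit.AtomisticToContinuum.Crystallization.Theorems.LjBilayerHcpSketch

/-- **The box point has energy `≤ U₀ = −179/250`** (certificate clause (U) + N1 + N5):
`e(hcp a₀ h₀) = (1/24)(a₀²)⁻⁶ P₆(49/60) − (1/12)(a₀²)⁻³ P₃(49/60) ≤ (1/24)(a₀²)⁻⁶ (B₆ + ρ⁻³T) − (1/12)(a₀²)⁻³ B₃`.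
[folklore] -/
theorem boxPoint_energy_le (Q : ℤ × ℤ × ℤ → ℝ)
    (hQ : Q = fun v => (v.2.1 : ℝ) ^ 2 + (v.2.1 : ℝ) * v.2.2 + (v.2.2 : ℝ) ^ 2 +
      (if Even v.1 then 0 else ((v.2.1 : ℝ) + v.2.2 + 1 / 3)))
    (B : ℕ → ℝ → ℝ)
    (hB : B = fun n x => ∑ v ∈ Finset.Icc (-12 : ℤ) 12 ×ˢ (Finset.Icc (-12 : ℤ) 12 ×ˢ Finset.Icc (-12 : ℤ) 12),
      if v = 0 then (0 : ℝ) else ((Q v + (v.1 : ℝ) ^ 2 * x ^ 2)⁻¹) ^ n)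
    (T : ℝ → ℝ)
    (h1 : ∀ (a h : ℝ) (ha : a ≠ 0) (hh : h ≠ 0),
      (Summable fun v : ℤ × ℤ × ℤ =>
        if v = 0 then (0 : ℝ) else ((a ^ 2 * Q v + (v.1 : ℝ) ^ 2 * h ^ 2)⁻¹) ^ 3) ∧
      (Summable fun v : ℤ × ℤ × ℤ =>
        if v = 0 then (0 : ℝ) else ((a ^ 2 * Q v + (v.1 : ℝ) ^ 2 * h ^ 2)⁻¹) ^ 6) ∧
      (hcpPeriodicConfiguration ha hh).energyPerParticle lennardJones =
        (1 / 24) * (∑' v : ℤ × ℤ × ℤ,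
            if v = 0 then (0 : ℝ) else ((a ^ 2 * Q v + (v.1 : ℝ) ^ 2 * h ^ 2)⁻¹) ^ 6) -
        (1 / 12) * (∑' v : ℤ × ℤ × ℤ,
            if v = 0 then (0 : ℝ) else ((a ^ 2 * Q v + (v.1 : ℝ) ^ 2 * h ^ 2)⁻¹) ^ 3))
    (h5 : ∀ (t : ℝ), 0 < t →
      (∑' v : ℤ × ℤ × ℤ,
          if (|v.1| ≤ ((12 : ℕ) : ℤ) ∧ |v.2.1| ≤ ((12 : ℕ) : ℤ) ∧ |v.2.2| ≤ ((12 : ℕ) : ℤ)) then (0 : ℝ)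
          else if v = 0 then (0 : ℝ) else (((1 : ℝ) ^ 2 * Q v + (v.1 : ℝ) ^ 2 * t ^ 2)⁻¹) ^ 3) ≤ T t)
    (hcU : (1 / 24) * (((97 / 100 : ℝ) ^ 2)⁻¹) ^ 6 *
          (B 6 (49 / 60) + ((min 1 (min (1 / 3 + (49 / 60 : ℝ) ^ 2) (4 * (49 / 60 : ℝ) ^ 2)))⁻¹) ^ 3 * T (49 / 60)) -
        (1 / 12) * (((97 / 100 : ℝ) ^ 2)⁻¹) ^ 3 * B 3 (49 / 60) ≤ -179 / 250)
    (ha₀ : (97 / 100 : ℝ) ≠ 0) (hh₀ : (97 / 100 * (49 / 60) : ℝ) ≠ 0) :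
    (hcpPeriodicConfiguration ha₀ hh₀).energyPerParticle lennardJones ≤ -179 / 250 := by
  have ht₀ : (97 / 100 * (49 / 60) : ℝ) / (97 / 100) = 49 / 60 := by norm_num
  rw [hcpEnergy_scaled Q h1, ht₀]
  obtain ⟨s3, s6⟩ := powerSums_summable_one Q h1 (49 / 60) (by norm_num)
  have hx : (0 : ℝ) < 49 / 60 := by norm_num
  have up6 := powerSum6_le_box_add_tail Q hQ T h5 (49 / 60) hx s3 s6
  have lo3 := box_le_powerSum Q hQ 3 (49 / 60) s3
  rw [hB] at hcU
  have c6 : (0 : ℝ) ≤ (1 / 24) * (((97 / 100 : ℝ) ^ 2)⁻¹) ^ 6 := by positivity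
  have c3 : (0 : ℝ) ≤ (1 / 12) * (((97 / 100 : ℝ) ^ 2)⁻¹) ^ 3 := by positivity
  nlinarith [mul_le_mul_of_nonneg_left up6 c6, mul_le_mul_of_nonneg_left lo3 c3]

/-- **Scaling of the cube sum** (any `Q`): `[v≠0](b²Q v + k²c²)⁻³ = (b²)⁻³ · [v≠0](Q v + k²(c/b)²)⁻³` for `b ≠ 0`.
[folklore] -/
theorem cubeFamily_scale (Q : ℤ × ℤ × ℤ → ℝ) (b c : ℝ) (hb : b ≠ 0) :
    (fun v : ℤ × ℤ × ℤ => if v = 0 then (0 : ℝ) else ((b ^ 2 * Q v + (v.1 : ℝ) ^ 2 * c ^ 2)⁻¹) ^ 3) =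
      fun v => ((b ^ 2)⁻¹) ^ 3 *
        (if v = 0 then (0 : ℝ) else ((Q v + (v.1 : ℝ) ^ 2 * (c / b) ^ 2)⁻¹) ^ 3) := by
  funext v
  split_ifs
  · simp
  · have e : b ^ 2 * Q v + (v.1 : ℝ) ^ 2 * c ^ 2 = b ^ 2 * (Q v + (v.1 : ℝ) ^ 2 * (c / b) ^ 2) := by
      field_simp
    rw [e, mul_inv, mul_pow]


/-- **Registered sub-goal `numericReduction_cubeFamily_scale` (anchor of this file):** binder-free spelling of
`cubeFamily_scale`. [folklore] -/
theorem numericReduction_cubeFamily_scale :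
    ∀ (Q : ℤ × ℤ × ℤ → ℝ) (b c : ℝ), b ≠ 0 →
      (fun v : ℤ × ℤ × ℤ => if v = 0 then (0 : ℝ) else ((b ^ 2 * Q v + (v.1 : ℝ) ^ 2 * c ^ 2)⁻¹) ^ 3) =
        fun v => ((b ^ 2)⁻¹) ^ 3 *
          (if v = 0 then (0 : ℝ) else ((Q v + (v.1 : ℝ) ^ 2 * (c / b) ^ 2)⁻¹) ^ 3) :=
  fun Q b c hb => cubeFamily_scale Q b c hb

/-- **Sν from N1, N2, N5 and the certificate.**  See the module docstring for the statement of the four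
hypotheses; the conclusion is the registered stub `stub_numeric` of line `Sketch` verbatim. [folklore] -/
theorem numeric_of_certificate
    (Q : ℤ × ℤ × ℤ → ℝ)
    (hQ : Q = fun v => (v.2.1 : ℝ) ^ 2 + (v.2.1 : ℝ) * v.2.2 + (v.2.2 : ℝ) ^ 2 +
      (if Even v.1 then 0 else ((v.2.1 : ℝ) + v.2.2 + 1 / 3)))
    (B : ℕ → ℝ → ℝ)
    (hB : B = fun n x => ∑ v ∈ Finset.Icc (-12 : ℤ) 12 ×ˢ (Finset.Icc (-12 : ℤ) 12 ×ˢ Finset.Icc (-12 : ℤ) 12),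
      if v = 0 then (0 : ℝ) else ((Q v + (v.1 : ℝ) ^ 2 * x ^ 2)⁻¹) ^ n)
    (T : ℝ → ℝ)
    -- N1
    (h1 : ∀ (a h : ℝ) (ha : a ≠ 0) (hh : h ≠ 0),
      (Summable fun v : ℤ × ℤ × ℤ =>
        if v = 0 then (0 : ℝ) else ((a ^ 2 * Q v + (v.1 : ℝ) ^ 2 * h ^ 2)⁻¹) ^ 3) ∧
      (Summable fun v : ℤ × ℤ × ℤ =>
        if v = 0 then (0 : ℝ) else ((a ^ 2 * Q v + (v.1 : ℝ) ^ 2 * h ^ 2)⁻¹) ^ 6) ∧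
      (hcpPeriodicConfiguration ha hh).energyPerParticle lennardJones =
        (1 / 24) * (∑' v : ℤ × ℤ × ℤ,
            if v = 0 then (0 : ℝ) else ((a ^ 2 * Q v + (v.1 : ℝ) ^ 2 * h ^ 2)⁻¹) ^ 6) -
        (1 / 12) * (∑' v : ℤ × ℤ × ℤ,
            if v = 0 then (0 : ℝ) else ((a ^ 2 * Q v + (v.1 : ℝ) ^ 2 * h ^ 2)⁻¹) ^ 3))
    -- N2
    (h2 : ∀ (n : ℕ) (a₁ h₁ a₂ h₂ : ℝ), 0 < a₁ → a₁ ≤ a₂ → 0 < h₁ → h₁ ≤ h₂ →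
      (Summable fun v : ℤ × ℤ × ℤ =>
        if v = 0 then (0 : ℝ) else ((a₁ ^ 2 * Q v + (v.1 : ℝ) ^ 2 * h₁ ^ 2)⁻¹) ^ n) →
      (Summable fun v : ℤ × ℤ × ℤ =>
        if v = 0 then (0 : ℝ) else ((a₂ ^ 2 * Q v + (v.1 : ℝ) ^ 2 * h₂ ^ 2)⁻¹) ^ n) ∧
      (∑' v : ℤ × ℤ × ℤ,
          if v = 0 then (0 : ℝ) else ((a₂ ^ 2 * Q v + (v.1 : ℝ) ^ 2 * h₂ ^ 2)⁻¹) ^ n) ≤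
        ∑' v : ℤ × ℤ × ℤ,
          if v = 0 then (0 : ℝ) else ((a₁ ^ 2 * Q v + (v.1 : ℝ) ^ 2 * h₁ ^ 2)⁻¹) ^ n)
    -- N5 at K = N = 12
    (h5 : ∀ (t : ℝ), 0 < t →
      (∑' v : ℤ × ℤ × ℤ,
          if (|v.1| ≤ ((12 : ℕ) : ℤ) ∧ |v.2.1| ≤ ((12 : ℕ) : ℤ) ∧ |v.2.2| ≤ ((12 : ℕ) : ℤ)) then (0 : ℝ)
          else if v = 0 then (0 : ℝ) else (((1 : ℝ) ^ 2 * Q v + (v.1 : ℝ) ^ 2 * t ^ 2)⁻¹) ^ 3) ≤ T t)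
    -- N4, the certificate
    (hc :
      ((1 / 24) * (((97 / 100 : ℝ) ^ 2)⁻¹) ^ 6 *
          (B 6 (49 / 60) + ((min 1 (min (1 / 3 + (49 / 60 : ℝ) ^ 2) (4 * (49 / 60 : ℝ) ^ 2)))⁻¹) ^ 3 * T (49 / 60)) -
        (1 / 12) * (((97 / 100 : ℝ) ^ 2)⁻¹) ^ 3 * B 3 (49 / 60) ≤ -179 / 250) ∧
      ((1 / 12) * (((3 / 2 : ℝ) ^ 2)⁻¹) ^ 3 * (B 3 (1 / 2) + T (1 / 2)) ≤ 179 / 250) ∧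
      ((B 3 (11 / 10) + T (11 / 10)) ^ 2 ≤
        24 * (∑ p ∈ Finset.Icc (-12 : ℤ) 12 ×ˢ Finset.Icc (-12 : ℤ) 12,
          if p = 0 then (0 : ℝ) else (((p.1 : ℝ) ^ 2 + (p.1 : ℝ) * p.2 + (p.2 : ℝ) ^ 2)⁻¹) ^ 6) * (179 / 250)) ∧
      (∀ t : ℝ, 1 / 2 ≤ t → t ≤ 11 / 10 → ∃ l r : ℚ, (l : ℝ) ≤ t ∧ t ≤ (r : ℝ) ∧ 0 < l ∧
        ((B 3 (l : ℝ) + T (l : ℝ)) ^ 2 ≤ 24 * B 6 (r : ℝ) * (179 / 250) ∨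
         ((39 / 50 : ℚ) ≤ l ∧ r ≤ (17 / 20 : ℚ) ∧
          (47 / 50 : ℝ) ^ 6 * (B 3 (l : ℝ) + T (l : ℝ)) ≤ B 6 (r : ℝ) ∧
          B 6 (l : ℝ) + ((min 1 (min (1 / 3 + (l : ℝ) ^ 2) (4 * (l : ℝ) ^ 2)))⁻¹) ^ 3 * T (l : ℝ) ≤
            B 3 (r : ℝ))))) :
    ∀ a h : ℝ, ∀ (ha : a ≠ 0) (hh : h ≠ 0), 2 / 3 ≤ a → 3 / 4 ≤ h →
      ∃ a' h' : ℝ, ∃ (ha' : a' ≠ 0) (hh' : h' ≠ 0),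
        47 / 50 ≤ a' ∧ a' ≤ 1 ∧ 39 / 50 * a' ≤ h' ∧ h' ≤ 17 / 20 * a' ∧
        (hcpPeriodicConfiguration ha' hh').energyPerParticle lennardJones ≤
          (hcpPeriodicConfiguration ha hh).energyPerParticle lennardJones := by
  classical
  obtain ⟨hcU, hcS, hcL, hcI⟩ := hc
  -- the box point
  have ha₀ : (97 / 100 : ℝ) ≠ 0 := by norm_num
  have hh₀ : (97 / 100 * (49 / 60) : ℝ) ≠ 0 := by norm_num
  have hU := boxPoint_energy_le Q hQ B hB T h1 h5 hcU ha₀ hh₀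
  -- box sums versus series (`hB` unfolded once)
  have hBle : ∀ (n : ℕ) (x : ℝ),
      (Summable fun v : ℤ × ℤ × ℤ => if v = 0 then (0 : ℝ) else ((Q v + (v.1 : ℝ) ^ 2 * x ^ 2)⁻¹) ^ n) →
      B n x ≤ ∑' v : ℤ × ℤ × ℤ, if v = 0 then (0 : ℝ) else ((Q v + (v.1 : ℝ) ^ 2 * x ^ 2)⁻¹) ^ n := by
    intro n x hs; rw [hB]; exact box_le_powerSum Q hQ n x hs
  have hBpos : ∀ (n : ℕ) (x : ℝ), 1 ≤ B n x := by
    intro n x; rw [hB]; exact one_le_boxSum Q hQ n x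
  have htail3 : ∀ x : ℝ, 0 < x →
      (Summable fun v : ℤ × ℤ × ℤ => if v = 0 then (0 : ℝ) else ((Q v + (v.1 : ℝ) ^ 2 * x ^ 2)⁻¹) ^ 3) →
      (∑' v : ℤ × ℤ × ℤ, if v = 0 then (0 : ℝ) else ((Q v + (v.1 : ℝ) ^ 2 * x ^ 2)⁻¹) ^ 3) ≤ B 3 x + T x := by
    intro x hx hs; rw [hB]; exact powerSum3_le_box_add_tail Q T h5 x hx hs
  have htail6 : ∀ x : ℝ, 0 < x →
      (Summable fun v : ℤ × ℤ × ℤ => if v = 0 then (0 : ℝ) else ((Q v + (v.1 : ℝ) ^ 2 * x ^ 2)⁻¹) ^ 3) →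
      (Summable fun v : ℤ × ℤ × ℤ => if v = 0 then (0 : ℝ) else ((Q v + (v.1 : ℝ) ^ 2 * x ^ 2)⁻¹) ^ 6) →
      (∑' v : ℤ × ℤ × ℤ, if v = 0 then (0 : ℝ) else ((Q v + (v.1 : ℝ) ^ 2 * x ^ 2)⁻¹) ^ 6) ≤
        B 6 x + ((min 1 (min (1 / 3 + x ^ 2) (4 * x ^ 2)))⁻¹) ^ 3 * T x := by
    intro x hx hs3 hs6; rw [hB]; exact powerSum6_le_box_add_tail Q hQ T h5 x hx hs3 hs6
  clear hB hcU
  /- ### the competitor -/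
  intro a h ha hh ha23 hh34
  have ha0 : 0 < a := by linarith
  have hh0 : 0 < h := by linarith
  set t : ℝ := h / a with ht
  have htpos : 0 < t := div_pos hh0 ha0
  obtain ⟨s3t, s6t⟩ := powerSums_summable_one Q h1 t htpos.ne'
  set P3 : ℝ := ∑' v : ℤ × ℤ × ℤ, if v = 0 then (0 : ℝ) else ((Q v + (v.1 : ℝ) ^ 2 * t ^ 2)⁻¹) ^ 3
    with hP3
  set P6 : ℝ := ∑' v : ℤ × ℤ × ℤ, if v = 0 then (0 : ℝ) else ((Q v + (v.1 : ℝ) ^ 2 * t ^ 2)⁻¹) ^ 6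
    with hP6
  have hP6pos : 0 < P6 := lt_of_lt_of_le (by linarith [hBpos 6 t]) (hBle 6 t s6t)
  have hP3pos : 0 < P3 := lt_of_lt_of_le (by linarith [hBpos 3 t]) (hBle 3 t s3t)
  set u : ℝ := ((a ^ 2)⁻¹) ^ 3 with hu
  have hEa : (hcpPeriodicConfiguration ha hh).energyPerParticle lennardJones =
      (P6 / 24) * u ^ 2 - (P3 / 12) * u := by
    rw [hcpEnergy_scaled Q h1 a h ha hh]; simp only [← ht, hu]; ring
  -- AM–GM
  have hAMGM : -(P3 ^ 2 / (24 * P6)) ≤ (hcpPeriodicConfiguration ha hh).energyPerParticle lennardJones := by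
    rw [hEa]
    have := quad_lower_bound (A := P6 / 24) (by positivity) (P3 / 12) u
    have e : (P3 / 12) ^ 2 / (4 * (P6 / 24)) = P3 ^ 2 / (24 * P6) := by
      field_simp; ring
    linarith [e ▸ this]
  -- the box point as a witness whenever `U₀ ≤ e(a, h)`
  have boxWitness : -179 / 250 ≤ (hcpPeriodicConfiguration ha hh).energyPerParticle lennardJones →
      ∃ a' h' : ℝ, ∃ (ha' : a' ≠ 0) (hh' : h' ≠ 0),
        47 / 50 ≤ a' ∧ a' ≤ 1 ∧ 39 / 50 * a' ≤ h' ∧ h' ≤ 17 / 20 * a' ∧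
        (hcpPeriodicConfiguration ha' hh').energyPerParticle lennardJones ≤
          (hcpPeriodicConfiguration ha hh).energyPerParticle lennardJones := fun hle =>
    ⟨97 / 100, 97 / 100 * (49 / 60), ha₀, hh₀, by norm_num, by norm_num, by norm_num, by norm_num,
      hU.trans hle⟩
  /- ### case split on the slope `t = h / a` -/
  rcases le_or_gt t (1 / 2) with hsmall | hlarge
  · -- (S) small slope: `a ≥ 3/2`, and the cube sum at `(a, h)` is below the one at `(3/2, 3/4)`
    apply boxWitness
    have ha32 : (3 / 2 : ℝ) ≤ a := by
      have : h ≤ a * (1 / 2) := by rwa [ht, div_le_iff₀ ha0, mul_comm] at hsmall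
      linarith
    obtain ⟨s30, -, -⟩ := h1 (3 / 2) (3 / 4) (by norm_num) (by norm_num)
    have anti := (h2 3 (3 / 2) (3 / 4) a h (by norm_num) ha32 (by norm_num) hh34 s30).2
    rw [cubeFamily_scale Q a h ha, cubeFamily_scale Q (3 / 2) (3 / 4) (by norm_num), tsum_mul_left,
      tsum_mul_left, show ((3 / 4 : ℝ) / (3 / 2)) = 1 / 2 by norm_num] at anti
    simp only [← ht] at anti
    obtain ⟨s3h, -⟩ := powerSums_summable_one Q h1 (1 / 2) (by norm_num)
    have up3 := htail3 (1 / 2) (by norm_num) s3h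
    have hfirst : 0 ≤ (P6 / 24) * u ^ 2 := by positivity
    rw [hEa]
    have c32 : (0 : ℝ) ≤ (((3 / 2 : ℝ) ^ 2)⁻¹) ^ 3 := by positivity
    nlinarith [mul_le_mul_of_nonneg_left up3 c32, hcS]
  rcases le_or_gt (11 / 10) t with hbig | hmid
  · -- (L) large slope: `P₃(t) ≤ P₃(11/10) ≤ B₃ + T`, `P₆(t) ≥ in-plane box sum`
    apply boxWitness
    refine le_trans ?_ hAMGM
    obtain ⟨s3l, -⟩ := powerSums_summable_one Q h1 (11 / 10) (by norm_num)
    have hP3le : P3 ≤ B 3 (11 / 10) + T (11 / 10) :=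
      (powerSums_antitone_one Q h2 3 (11 / 10) t (by norm_num) hbig s3l).trans
        (htail3 (11 / 10) (by norm_num) s3l)
    -- in-plane part of `P₆`
    obtain ⟨S0, hS0⟩ : ∃ S0 : ℝ, S0 = ∑ p ∈ Finset.Icc (-12 : ℤ) 12 ×ˢ Finset.Icc (-12 : ℤ) 12,
      if p = 0 then (0 : ℝ) else (((p.1 : ℝ) ^ 2 + (p.1 : ℝ) * p.2 + (p.2 : ℝ) ^ 2)⁻¹) ^ 6 := ⟨_, rfl⟩
    rw [← hS0] at hcL
    have hS0le : S0 ≤ P6 := by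
      let emb : ℤ × ℤ ↪ ℤ × ℤ × ℤ := ⟨fun p => ((0 : ℤ), p), fun p q hpq => by simpa using hpq⟩
      have hsum : S0 = ∑ v ∈ (Finset.Icc (-12 : ℤ) 12 ×ˢ Finset.Icc (-12 : ℤ) 12).map emb,
          (if v = 0 then (0 : ℝ) else ((Q v + (v.1 : ℝ) ^ 2 * t ^ 2)⁻¹) ^ 6) := by
        rw [hS0, Finset.sum_map]
        refine Finset.sum_congr rfl fun p _ => ?_
        simp only [hQ, emb, Function.Embedding.coeFn_mk, Prod.mk_eq_zero, Int.cast_zero,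
          Even.zero, if_true, add_zero]
        by_cases hp : p = 0
        · simp [hp]
        · rw [if_neg hp, if_neg (fun h0 => hp h0.2)]
          ring
      rw [hsum]
      exact sum_le_tsum_of_nonneg s6t (powerSums_term_nonneg Q hQ 6 t) _
    clear hS0 -- keep the explicit `Finset.sum` away from `linarith`'s preprocessing
    have hBT1 : 1 ≤ B 3 (11 / 10) + T (11 / 10) := by
      have := htail3 (11 / 10) (by norm_num) s3l
      linarith [hBle 3 (11 / 10) s3l, hBpos 3 (11 / 10)]
    have hS0pos : 0 < S0 := by
      have hsq : 1 ≤ (B 3 (11 / 10) + T (11 / 10)) ^ 2 := one_le_pow₀ hBT1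
      linarith
    have hnum : P3 ^ 2 ≤ (B 3 (11 / 10) + T (11 / 10)) ^ 2 := pow_le_pow_left₀ hP3pos.le hP3le 2
    have key : P3 ^ 2 / (24 * P6) ≤ (B 3 (11 / 10) + T (11 / 10)) ^ 2 / (24 * S0) :=
      div_le_div₀ (sq_nonneg _) hnum (by linarith) (by linarith)
    have key2 : (B 3 (11 / 10) + T (11 / 10)) ^ 2 / (24 * S0) ≤ 179 / 250 := by
      rw [div_le_iff₀ (by linarith)]
      linarith [hcL]
    linarith
  · -- middle slopes: the certified interval containing `t`
    obtain ⟨l, r, hl, hr, hl0, hcase⟩ := hcI t hlarge.le hmid.le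
    have hl0' : (0 : ℝ) < l := by exact_mod_cast hl0
    have hr0' : (0 : ℝ) < r := hl0'.trans_le (hl.trans hr)
    obtain ⟨s3l, s6l⟩ := powerSums_summable_one Q h1 l hl0'.ne'
    obtain ⟨s3r, s6r⟩ := powerSums_summable_one Q h1 r hr0'.ne'
    have hP3up : P3 ≤ B 3 l + T l :=
      (powerSums_antitone_one Q h2 3 l t hl0' hl s3l).trans (htail3 l hl0' s3l)
    have hP6lo : B 6 r ≤ P6 := (hBle 6 r s6r).trans (powerSums_antitone_one Q h2 6 t r htpos hr s6t)
    have hP6up : P6 ≤ B 6 l + ((min 1 (min (1 / 3 + (l : ℝ) ^ 2) (4 * (l : ℝ) ^ 2)))⁻¹) ^ 3 * T l :=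
      (powerSums_antitone_one Q h2 6 l t hl0' hl s6l).trans (htail6 l hl0' s3l s6l)
    have hP3lo : B 3 r ≤ P3 := (hBle 3 r s3r).trans (powerSums_antitone_one Q h2 3 t r htpos hr s3t)
    rcases hcase with hBcase | hA
    · -- (B): the box point wins
      apply boxWitness
      refine le_trans ?_ hAMGM
      have hnum : P3 ^ 2 ≤ (B 3 l + T l) ^ 2 := pow_le_pow_left₀ hP3pos.le hP3up 2
      have hBr : 1 ≤ B 6 r := hBpos 6 r
      have key : P3 ^ 2 / (24 * P6) ≤ (B 3 l + T l) ^ 2 / (24 * B 6 r) :=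
        div_le_div₀ (sq_nonneg _) hnum (by linarith) (by linarith)
      have key2 : (B 3 l + T l) ^ 2 / (24 * B 6 r) ≤ 179 / 250 := by
        rw [div_le_iff₀ (by linarith)]
        linarith [hBcase]
      linarith
    · -- (A): the hcp on the ray `t` with `a'⁶ = P₆/P₃` is in the box and realises the AM–GM bound
      have hl78 : (39 / 50 : ℚ) ≤ l := hA.1
      have hr85 : r ≤ (17 / 20 : ℚ) := hA.2.1
      have hA1 : (47 / 50 : ℝ) ^ 6 * (B 3 l + T l) ≤ B 6 r := hA.2.2.1
      have hA2 : B 6 l + ((min 1 (min (1 / 3 + (l : ℝ) ^ 2) (4 * (l : ℝ) ^ 2)))⁻¹) ^ 3 * T l ≤ B 3 r :=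
        hA.2.2.2
      clear hA
      set X : ℝ := P6 / P3 with hX
      have hX0 : 0 < X := div_pos hP6pos hP3pos
      obtain ⟨a', ha'0, ha'6⟩ := exists_pow_six_eq hX0
      have hXlo : (47 / 50 : ℝ) ^ 6 ≤ X := by
        rw [hX, le_div_iff₀ hP3pos]
        have : (47 / 50 : ℝ) ^ 6 * P3 ≤ (47 / 50 : ℝ) ^ 6 * (B 3 l + T l) :=
          mul_le_mul_of_nonneg_left hP3up (by positivity)
        linarith
      have hXhi : X ≤ 1 := by
        rw [hX, div_le_one hP3pos]
        linarith
      have h6lo : (47 / 50 : ℝ) ^ 6 ≤ a' ^ 6 := by rw [ha'6]; exact hXlo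
      have h6hi : a' ^ 6 ≤ (1 : ℝ) ^ 6 := by rw [ha'6, one_pow]; exact hXhi
      obtain ⟨ha'lo, ha'hi⟩ := le_and_le_of_pow_six (c := 47 / 50) (d := 1) ha'0.le zero_le_one h6lo h6hi
      have hl78' : (39 / 50 : ℝ) ≤ l := by
        have := (Rat.cast_le (K := ℝ)).2 hl78; push_cast at this; exact this
      have hr85' : (r : ℝ) ≤ 17 / 20 := by
        have := (Rat.cast_le (K := ℝ)).2 hr85; push_cast at this; exact this
      have ht78 : 39 / 50 ≤ t := hl78'.trans hl
      have ht85 : t ≤ 17 / 20 := hr.trans hr85'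
      refine ⟨a', t * a', ha'0.ne', (mul_pos htpos ha'0).ne', ha'lo, ha'hi,
        mul_le_mul_of_nonneg_right ht78 ha'0.le, mul_le_mul_of_nonneg_right ht85 ha'0.le, ?_⟩
      -- energy of the witness: `u' = (a'²)⁻³ = X⁻¹ = P₃/P₆`
      have hta : t * a' / a' = t := by field_simp
      rw [hcpEnergy_scaled Q h1 a' (t * a') ha'0.ne' (mul_pos htpos ha'0).ne', hta]
      simp only [← hP3, ← hP6]
      have hu' : ((a' ^ 2)⁻¹) ^ 3 = P3 / P6 := by
        rw [← inv_pow, ← pow_mul, show 2 * 3 = 6 by norm_num, inv_pow, ha'6, hX, inv_div]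
      have hu'2 : ((a' ^ 2)⁻¹) ^ 6 = (P3 / P6) ^ 2 := by
        rw [show ((a' ^ 2)⁻¹) ^ 6 = (((a' ^ 2)⁻¹) ^ 3) ^ 2 by ring, hu']
      rw [hu', hu'2]
      refine le_trans (le_of_eq ?_) hAMGM
      field_simp
      ring

end Summit.AtomisticToContinuum.Crystallization.Theorems.LjBilayerHcpSketch

end
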